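import Mathlib
import Summits.Ventures.PercRepro2.Defs
import Summits.Ventures.PercRepro2.Independence
import Summits.Ventures.PercRepro2.Harris
import Summits.Ventures.PercRepro2.Graph
import Summits.Ventures.PercRepro2.Events
import Summits.Ventures.PercRepro2.Induced
import Summits.Ventures.PercRepro2.BHKAvoid
import Summits.Ventures.PercRepro2.ZCPendantSecondOrder

/-!
# (CD₀): the up-set-free core of row 2′CD is a theorem (blind cell PercRepro2, mine-a g30; MINE-A.md §85.14)

Two roots `a₁, a₂`, marks `a₃, o`; `Q = {a₁ ↮ a₂}`, `U = C₁ ∪ C₂` the union of the root clusters,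
`e = {a₃ ∈ C₁}`, `f = {o ∈ C₂}`, `N = {a₃ ∉ U}`, `oU = {o ∈ U}`.  The case `𝒰 = {a₃ ∈ C₁}` of
row 2′CD (`(CD) = (DOM_a)`: `Cov_Q(1_𝒰, e(γ − f)) ≥ 0`, `γ = P_Q(oU ∣ N)`) is

  `(CD₀)   P(Q ∩ e ∩ f) · P(Q ∩ N) ≤ P(Q ∩ e) · P(Q ∩ N ∩ oU)`,

i.e. `P_Q(o ∈ C₂ ∣ a₃ ∈ C₁) ≤ P_Q(o ∈ C₁ ∪ C₂ ∣ a₃ ∉ C₁ ∪ C₂)`.  Proof: with `R = {C₂ ↮ {a₁, a₃}}`,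
`A = P(R e f)`, `B = P(R eᶜ f)`, `C = P(R e fᶜ)`, `D = P(R eᶜ fᶜ)`, `Ψ = P(R eᶜ fᶜ ∩ {o ∈ C₁})`, the four
probabilities are `A`, `B + D`, `A + C`, `B + Ψ`, and `(A + C)(B + Ψ) − A(B + D) = (CB − AD) + Ψ(A + C)`,
where `CB − AD ≥ 0` is the van den Berg–Häggström–Kahn cross-cluster inequality with the cluster of
`a₂` avoiding `{a₁, a₃}` (`bhk_cross_cluster_avoid`: `{o ∈ C₂}` and `{a₃ ∈ C₁}` negatively correlated
given `R`).  No definition; one seat.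
-/

namespace Summit.Ventures.PercRepro2

namespace CDZero

section Sets

variable {V : Type*} {E : Type*} (ends : E → Sym2 V) (a₁ a₂ a₃ o : V)

/-- `{a₂ ↮ {a₁, a₃}} = {a₁ ↮ a₂} ∩ {a₂ ↮ a₃}`. -/
lemma avoidAll_a₂_pair_eq [DecidableEq V] :
    avoidAll ends a₂ {a₁, a₃} = (connEvent ends a₁ a₂)ᶜ ∩ (connEvent ends a₂ a₃)ᶜ := by
  ext ω
  simp only [mem_avoidAll, Finset.mem_insert, Finset.mem_singleton, Set.mem_inter_iff,
    Set.mem_compl_iff, mem_connEvent]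
  constructor
  · intro h
    exact ⟨fun h' => h a₁ (Or.inl rfl) (conn_symm h'), h a₃ (Or.inr rfl)⟩
  · rintro ⟨h1, h2⟩ x hx
    rcases hx with rfl | rfl
    · exact fun h' => h1 (conn_symm h')
    · exact h2

/-- Under `{a₁ ↮ a₂}`, `{a₃ ∈ C₁}` forces `{a₃ ∉ C₂}`:
`Q ∩ e = Q ∩ (a₂ ↮ a₃) ∩ e`. -/
lemma Q_inter_e_eq :
    (connEvent ends a₁ a₂)ᶜ ∩ connEvent ends a₁ a₃ =
      (connEvent ends a₁ a₂)ᶜ ∩ (connEvent ends a₂ a₃)ᶜ ∩ connEvent ends a₁ a₃ := by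
  ext ω
  simp only [Set.mem_inter_iff, Set.mem_compl_iff, mem_connEvent]
  constructor
  · rintro ⟨h1, h2⟩
    exact ⟨⟨h1, fun h3 => h1 (conn_trans h2 (conn_symm h3))⟩, h2⟩
  · rintro ⟨⟨h1, _⟩, h2⟩
    exact ⟨h1, h2⟩

end Sets

section Main

variable {V : Type*} {E : Type*} [Fintype E] [DecidableEq E] [Fintype V] [DecidableEq V]
  {R : Type*} [Field R] [LinearOrder R] [IsStrictOrderedRing R]

/-- **(CD₀)**: `P(Q ∩ e ∩ f) · P(Q ∩ N) ≤ P(Q ∩ e) · P(Q ∩ N ∩ oU)` with `Q = {a₁ ↮ a₂}`,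
`e = {a₃ ∈ C₁}`, `f = {o ∈ C₂}`, `N = {a₃ ∉ C₁} ∩ {a₃ ∉ C₂}`, `oU = {o ∈ C₁} ∪ {o ∈ C₂}`. -/
theorem cd_zero (p : E → R) (hp : IsProbVec p) (ends : E → Sym2 V) (a₁ a₂ a₃ o : V) :
    let Q := (connEvent ends a₁ a₂)ᶜ
    let e := connEvent ends a₁ a₃
    let f := connEvent ends a₂ o
    let N := (connEvent ends a₁ a₃)ᶜ ∩ (connEvent ends a₂ a₃)ᶜ
    let oU := connEvent ends a₁ o ∪ connEvent ends a₂ o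
    prob p (Q ∩ e ∩ f) * prob p (Q ∩ N) ≤ prob p (Q ∩ e) * prob p (Q ∩ N ∩ oU) := by
  intro Q e f N oU
  -- the avoidance world `R = {a₂ ↮ {a₁, a₃}}`
  set Rv := avoidAll ends a₂ {a₁, a₃} with hRv
  have hR : Rv = Q ∩ (connEvent ends a₂ a₃)ᶜ := avoidAll_a₂_pair_eq ends a₁ a₂ a₃
  -- BHK cross-cluster: `{o ∈ C₂}` (of `C₂`) vs `{a₃ ∈ C₁}` (of `C₁`) given `R`
  have hbhk := bhk_cross_cluster_avoid p hp ends a₂ a₁ (X := {a₁, a₃}) (by simp)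
    (ZCPendant.isUpperSet_mem_o (V := V) o) (ZCPendant.isUpperSet_mem_o (V := V) a₃)
  rw [ZCPendant.clusterInEvent_mem_o_eq, ZCPendant.clusterInEvent_mem_o_eq] at hbhk
  -- `hbhk : P(f ∩ e ∩ R) * P(R) ≤ P(f ∩ R) * P(e ∩ R)`
  -- the four pieces
  have s1 : Q ∩ e = Rv ∩ e := by rw [hR]; exact Q_inter_e_eq ends a₁ a₂ a₃
  have s2 : Q ∩ e ∩ f = f ∩ e ∩ Rv := by
    rw [s1, Set.inter_comm Rv e, Set.inter_assoc, Set.inter_comm Rv f, ← Set.inter_assoc,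
      Set.inter_comm e f]
  have s3 : Q ∩ N = Rv ∩ eᶜ := by
    rw [hR]
    ext ω
    simp only [N, Set.mem_inter_iff, Set.mem_compl_iff]
    tauto
  have s4 : Q ∩ N ∩ oU = (Rv ∩ eᶜ ∩ f) ∪ (Rv ∩ eᶜ ∩ fᶜ ∩ connEvent ends a₁ o) := by
    rw [s3]
    ext ω
    simp only [oU, Set.mem_inter_iff, Set.mem_union, Set.mem_compl_iff]
    tauto
  -- probabilities
  have hA : prob p (f ∩ e ∩ Rv) = prob p (Q ∩ e ∩ f) := by rw [s2]
  have hRe : prob p (e ∩ Rv) = prob p (Q ∩ e) := by rw [s1, Set.inter_comm]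
  have hfR : prob p (f ∩ Rv) = prob p (f ∩ e ∩ Rv) + prob p (f ∩ eᶜ ∩ Rv) := by
    have := prob_inter_add_prob_inter_compl p (f ∩ Rv) e
    rw [Set.inter_right_comm f Rv e, Set.inter_right_comm f Rv eᶜ] at this
    exact this.symm
  have hRsplit : prob p Rv = prob p (e ∩ Rv) + prob p (Rv ∩ eᶜ) := by
    have := prob_inter_add_prob_inter_compl p Rv e
    rw [Set.inter_comm Rv e] at this
    exact this.symm
  have hRe_split : prob p (e ∩ Rv) = prob p (f ∩ e ∩ Rv) + prob p (Rv ∩ e ∩ fᶜ) := by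
    have := prob_inter_add_prob_inter_compl p (e ∩ Rv) f
    rw [show e ∩ Rv ∩ f = f ∩ e ∩ Rv by
      rw [Set.inter_comm (e ∩ Rv) f, ← Set.inter_assoc],
      show e ∩ Rv ∩ fᶜ = Rv ∩ e ∩ fᶜ by rw [Set.inter_comm e Rv]] at this
    exact this.symm
  have hRec_split : prob p (Rv ∩ eᶜ) = prob p (f ∩ eᶜ ∩ Rv) + prob p (Rv ∩ eᶜ ∩ fᶜ) := by
    have := prob_inter_add_prob_inter_compl p (Rv ∩ eᶜ) f
    rw [show Rv ∩ eᶜ ∩ f = f ∩ eᶜ ∩ Rv by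
      rw [Set.inter_comm (Rv ∩ eᶜ) f, Set.inter_comm Rv eᶜ, ← Set.inter_assoc]] at this
    exact this.symm
  have hΨ : prob p (Q ∩ N ∩ oU) =
      prob p (f ∩ eᶜ ∩ Rv) + prob p (Rv ∩ eᶜ ∩ fᶜ ∩ connEvent ends a₁ o) := by
    rw [s4, prob_union_of_disjoint]
    · rw [show Rv ∩ eᶜ ∩ f = f ∩ eᶜ ∩ Rv by
        rw [Set.inter_comm (Rv ∩ eᶜ) f, Set.inter_comm Rv eᶜ, ← Set.inter_assoc]]
    · refine Set.disjoint_left.mpr fun ω h1 h2 => ?_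
      exact h2.1.2 h1.2
  have hΨle : prob p (Rv ∩ eᶜ ∩ fᶜ ∩ connEvent ends a₁ o) ≤ prob p (Rv ∩ eᶜ ∩ fᶜ) :=
    prob_mono hp Set.inter_subset_left
  have hΨ0 : 0 ≤ prob p (Rv ∩ eᶜ ∩ fᶜ ∩ connEvent ends a₁ o) := prob_nonneg hp _
  have hA0 : 0 ≤ prob p (f ∩ e ∩ Rv) := prob_nonneg hp _
  have hC0 : 0 ≤ prob p (Rv ∩ e ∩ fᶜ) := prob_nonneg hp _
  have hB0 : 0 ≤ prob p (f ∩ eᶜ ∩ Rv) := prob_nonneg hp _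
  have hD0 : 0 ≤ prob p (Rv ∩ eᶜ ∩ fᶜ) := prob_nonneg hp _
  -- assemble: (A + C)(B + Ψ) − A(B + D) = (CB − AD) + Ψ(A + C), and CB − AD ≥ 0 from hbhk
  rw [← hA, ← hRe, hΨ, s3, hRec_split]
  rw [hRsplit, hRec_split, hfR, hRe_split] at hbhk
  nlinarith [hbhk, mul_nonneg hΨ0 hA0, mul_nonneg hΨ0 hC0, hB0, hD0, hRe_split]

end Main

end CDZero

end Summit.Ventures.PercRepro2
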